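import Literature.MathematicalPhysics.KineticTheory.NewtonianFlowLiouville
import Literature.Barriers.AtomisticToContinuum.AnticontinuumLocalizationProofs
import HarnessLib

/-!
# The rotor chain as a Newtonian flow (bridge to `KineticTheory/NewtonianFlow*.lean`)

`Literature/Barriers/AtomisticToContinuum/` — bridging lemmas identifying the rotor-chain flow
notions of `AnticontinuumLocalization.lean` / `AnticontinuumLocalizationProofs.lean` with the
general force-field–parametric ones of
`Literature/MathematicalPhysics/KineticTheory/NewtonianFlow.lean` at `F := RotorChain.force N ε γ`:

* `RotorChain.field_eq_vectorField : field N ε γ = NewtonianFlow.vectorField (force N ε γ)` (rfl);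
* `RotorChain.isFlow_iff_newtonian : RotorChain.IsFlow N ε γ Φ ↔ NewtonianFlow.IsFlow (force N ε γ) Φ`;
* `RotorChain.driftStep_eq`, `kickStep_eq`, `eulerStep_eq_newtonian` (the symplectic-Euler shears
  agree, rfl);
* `RotorChain.lipschitzWith_force` and, as the instance of the general Liouville theorem
  `NewtonianFlow.IsFlow.measurePreserving`, a second proof
  `RotorChain.IsFlow.measurePreserving_newtonian` of `RotorChain.IsFlow.measurePreserving`.

This records that the Barriers-side declarations are the `F := force N ε γ` instances of the
KineticTheory ones (imports flow Barriers → KineticTheory), as asked for in the review of the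
general files; a later librarian pass may re-derive the special ones from the general ones.
-/

noncomputable section

open MeasureTheory

namespace Literature.Barriers.AtomisticToContinuum.HeatConduction.RotorChain

open Literature.MathematicalPhysics.KineticTheory Literature.MathematicalPhysics.KineticTheory.HeatConduction

variable {N : ℕ}

/-- The rotor vector field is the Newtonian field of `force`. [folklore] -/
theorem field_eq_vectorField (N : ℕ) (ε γ : ℝ) :
    field N ε γ = NewtonianFlow.vectorField (force N ε γ) := rfl

/-- The rotor drift shear is the general one. [folklore] -/
theorem driftStep_eq (h : ℝ) : driftStep (N := N) h = NewtonianFlow.drift h := rfl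

/-- The rotor kick shear is the general one at `F := force`. [folklore] -/
theorem kickStep_eq (N : ℕ) (ε γ h : ℝ) : kickStep N ε γ h = NewtonianFlow.kick (force N ε γ) h := rfl

/-- The rotor symplectic-Euler step is the general one at `F := force`. [folklore] -/
theorem eulerStep_eq_newtonian (N : ℕ) (ε γ h : ℝ) :
    eulerStep N ε γ h = NewtonianFlow.eulerStep (force N ε γ) h := rfl

/-- The rotor force is globally Lipschitz with constant `|ε|(|γ| + 4)`. [folklore] -/
theorem lipschitzWith_force (N : ℕ) (ε γ : ℝ) :
    LipschitzWith ⟨|ε| * (|γ| + 4), by positivity⟩ (fun q : Fin N → ℝ => force N ε γ q) :=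
  lipschitzWith_iff_norm_sub_le.2 fun q q' => norm_force_sub_force_le ε γ q q'

/-- **Bridge**: a flow map of the rotor chain in the sense of `RotorChain.IsFlow` (Hamilton's
equations componentwise) is exactly a Newtonian flow for the force field `force N ε γ`.
[folklore] -/
theorem isFlow_iff_newtonian {ε γ : ℝ} {Φ : ℝ → PhaseSpace N → PhaseSpace N} :
    IsFlow N ε γ Φ ↔ NewtonianFlow.IsFlow (fun q => force N ε γ q) Φ := by
  constructor
  · intro hΦ
    exact ⟨hΦ.continuous, hΦ.map_zero, fun z t => hΦ.hasDerivAt z t⟩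
  · rintro ⟨hc, h0, hd⟩
    refine ⟨hc, h0, fun z x t => ⟨?_, ?_⟩⟩
    · have h1 := (((ContinuousLinearMap.proj x).comp
        (ContinuousLinearMap.fst ℝ (Fin N → ℝ) (Fin N → ℝ))).hasFDerivAt).comp_hasDerivAt t (hd z t)
      exact h1
    · have h2 := (((ContinuousLinearMap.proj x).comp
        (ContinuousLinearMap.snd ℝ (Fin N → ℝ) (Fin N → ℝ))).hasFDerivAt).comp_hasDerivAt t (hd z t)
      rw [partialQ_hamiltonian, neg_neg]
      exact h2

/-- **Liouville for the rotor chain as an instance of the general theorem**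
`NewtonianFlow.IsFlow.measurePreserving` (bounded Lipschitz force): a second proof of
`RotorChain.IsFlow.measurePreserving`. [cite: Arnold1978, §16 Thm 1] -/
theorem IsFlow.measurePreserving_newtonian {ε γ : ℝ} {Φ : ℝ → PhaseSpace N → PhaseSpace N}
    (hΦ : IsFlow N ε γ Φ) (t : ℝ) :
    MeasurePreserving (Φ t) (volume : Measure (PhaseSpace N)) volume :=
  (isFlow_iff_newtonian.1 hΦ).measurePreserving (lipschitzWith_force N ε γ)
    (fun q => norm_force_le ε γ q) (continuous_force N ε γ) t

end Literature.Barriers.AtomisticToContinuum.HeatConduction.RotorChain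

end
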